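import Summits.BirchSwinnertonDyer.BirchSwinnertonDyer.Theorems.KimAtThreeDeepUpperOfPortsDevissage
import Summits.BirchSwinnertonDyer.BirchSwinnertonDyer.Theorems.KimAtThreeKolyvaginIsogenyKatoStratum
import HarnessLib

/-!
# Route `KimAtThreeKolyvagin` (rung W2), crux `DeepUpperAtThree` (item 19076): the END-OF-PORTS theorem
# over the NAMED Poitou–Tate fact and CLASS-WIDE along prime-to-`3` isogenies; and 19077 on the same
# stratum from the same inputs

Cell `bsd-addord`, seat `bsd-addord-w2-c3` (D-0074 row B6), item `stmt-BirchSwinnertonDyer-19076`.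
Sequel of `KimAtThreeDeepUpperOfPortsDevissage` (p433736), in the shape of kim3's
`KimAtThreeKolyvaginIsogenyKatoStratum` (p427395) for crux 19075.  Theorems only (no definition, no named
fact, no `sorry`); cruxes 19076/19077 stay OPEN; nothing asserted about any curve.
* `deepUpper_optimal_of_ports_of_poitouTate` — the nine Poitou–Tate binders supplied by the named fact
  `poitouTate_selmerStructure_duality ℚ` (`hPT 3`, `exists_localInvariants_three_pow_of_poitouTate`);
* **`deepUpper_conclusion_classwide_of_ports_of_poitouTate`** — for ANY globally minimal `W`
  `ℚ`-isogenous to an optimal `W₀` of the Kato stratum (`3 ∤ c₃(W₀)`, optimal datum `D₀` with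
  `3 ∤ c_{D₀}`, port at `(v₃, η, D₀)`, STUB at `W₀`), with the tower onto, additive `3`, `E(ℚ₃)[3] = 0`,
  `3`-integral plus symbols and `ord(δ̃) = 0` for `D₀.f`: crux 19076's conclusion AT `W`
  (row binders transported to `W₀` by kim3's isogeny lemmas, conclusion transported back by
  `deepUpper_conclusion_iff_of_isIsogenous`);
* **`shallowEqDeep_conclusion_classwide_of_ports_of_stub`** — crux 19077's conclusion on the same rows
  from the SAME inputs (kim3's `shallowEqDeep_conclusion_classwide_of_ports_of_deepUpper` fed with the
  previous theorem: its hypothesis `hU` = 19076 at `W` is now produced, not assumed).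
GRANTED: `hS24`/`hS24₂` (PUB), GZK (PUB), `poitouTate_selmerStructure_duality ℚ` (PUB), ONE port
`KatoKuriharaPortThreeAtWith₂ W₀ 0 v₃ η D₀` (FLAG `K22-Thm3.13-PORT@3`), ONE new inline port `hStub`
(Mazur–Rubin Thm. 4.4.1 at `∅`, general `m`), and Carayol's level = conductor as the binder `hN`.
[cite: Kim2025RefinedTNC, Thm 1.1, §5] [cite: Kim2022StructureSelmer, Thm. 1.9 (6) and Thm. 3.13]
[cite: MazurRubin2004, Thm. 4.4.1 and Cor. 4.1.9] [cite: MilneADT2006, Ch. I, Thm. 4.10] [cite: SilvermanAEC2009, Cor. III.4.11]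
-/

set_option autoImplicit false
-- the Theorems namespace of a single-conjunct summit repeats the summit name by design (D-0017)
set_option linter.dupNamespace false

noncomputable section

open scoped Classical NumberField
open Function Field NumberField IsDedekindDomain WeierstrassCurve CongruenceSubgroup
  Literature.NumberTheory.EllipticCurves Literature.NumberTheory.EllipticCurves.ModularForms
  Literature.NumberTheory.EllipticCurves.Rank1Residual
  Literature.NumberTheory.GaloisRepresentations Literature.NumberTheory.GaloisCohomology
  Summit.BirchSwinnertonDyer.Rank1Residual.GaloisImage Summit.BirchSwinnertonDyer.Rank1Residual.X4
  Summit.BirchSwinnertonDyer.BirchSwinnertonDyer.Theorems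
  Summit.BirchSwinnertonDyer.BirchSwinnertonDyer.Theorems.KimAtThreeKolyvaginIsogenyInvariance
  Summit.BirchSwinnertonDyer.BirchSwinnertonDyer.Theorems.KimAtThreeKolyvaginIsogenyTransport
  Summit.BirchSwinnertonDyer.BirchSwinnertonDyer.Theorems.KimAtThreeKolyvaginIsogenyCruxes
  Summit.BirchSwinnertonDyer.BirchSwinnertonDyer.Theorems.KimAtThreeDeepLowerKatoStratumOfFacts
  Summit.BirchSwinnertonDyer.BirchSwinnertonDyer.Theorems.KimAtThreeKolyvaginIsogenyKatoStratum
  Summit.BirchSwinnertonDyer.BirchSwinnertonDyer.Theorems.KimAtThreeDeepUpperOfPortsDevissage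

namespace Summit.BirchSwinnertonDyer.BirchSwinnertonDyer.Theorems.KimAtThreeDeepUpperOfPortsClasswide

/-- **Crux 19076 at an OPTIMAL datum of the Kato stratum, GRANTED three named published facts, ONE port
and the STUB**: `deepUpper_optimal_of_ports_of_towerSurj` with its Poitou–Tate binders supplied by
`poitouTate_selmerStructure_duality ℚ`. [cite: Kim2025RefinedTNC, Thm 1.1] [cite: MilneADT2006, Ch. I, Thm. 4.10]
[cite: MazurRubin2004, Thm. 4.4.1] -/
theorem deepUpper_optimal_of_ports_of_poitouTate
    (hS24 : Sakamoto2024.kolyvaginSystems_freeRankOne_zmod_three_pow)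
    (hS24₂ : Sakamoto2024.kolyvaginSystems_idealOfBasis_eq_fittingIdeal_zmod_three_pow)
    (hGZK : rank_eq_analyticRank_of_analyticRank_le_one)
    (hPT : poitouTate_selmerStructure_duality ℚ)
    (W : WeierstrassCurve ℚ) [W.IsElliptic] [W.IsGloballyMinimal]
    (hadd : haveI : Fact (Nat.Prime 3) := ⟨Nat.prime_three⟩; Addv W 3)
    (hc3 : ¬ 3 ∣ (W.baseChange ℚ_[3]).localTamagawaNumber ℤ_[3])
    (htower : ∀ m : ℕ, W.HasSurjectiveModNGaloisRep (3 ^ m : ℕ))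
    (ht0 : Nat.card {Q : (W.baseChange ℚ_[3]).toAffine.Point // (3 : ℕ) • Q = 0} = 1)
    {N : ℕ} [NeZero N] (D : ModularParametrizationData W N)
    (hopt : ∀ z ∈ D.L.lattice, ∃ w ∈ periodLattice D.f, z = D.c * w)
    (hcD : ¬ (3 : ℤ) ∣ D.maninConstant)
    (hint : ∀ r : ℚ, ratPlusSymbol D.f r ≠ 0 → 0 ≤ padicValRat 3 (ratPlusSymbol D.f r))
    (hord : kuriharaVanishingOrder W 3 D.f = 0)
    (v₃ : HeightOneSpectrum (𝓞 ℚ)) (hv₃ : ((3 : ℕ) : 𝓞 ℚ) ∈ v₃.asIdeal)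
    (η : (q : HeightOneSpectrum (𝓞 ℚ)) → (ZMod (Ideal.absNorm q.asIdeal))ˣ)
    (hη : ∀ q : HeightOneSpectrum (𝓞 ℚ), Subgroup.zpowers (η q) = ⊤)
    (hPort : KatoKuriharaPortThreeAtWith₂ W 0 v₃ η D)
    (hStub : ∀ (k : ℕ)
      (Dk : KolyvaginDatum (W.torsionGaloisModule (((3 : ℕ) : ℤ) ^ k * ((3 : ℕ) : ℤ))))
      (g : Finset (HeightOneSpectrum (𝓞 ℚ)) →
        galoisCohomology (W.torsionGaloisModule (((3 : ℕ) : ℤ) ^ k * ((3 : ℕ) : ℤ))) 1)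
      (n₀ : ℕ), Dk.IsCanonicalTauDatumThreeAtWith W k k η →
        g ∈ Dk.kolyvaginSystems (propagatedSelmerStructure W 3 k) →
        (∀ κ ∈ Dk.kolyvaginSystems (propagatedSelmerStructure W 3 k), ∃ a : ℕ, κ = a • g) →
        Nat.card (propagatedSelmerStructure W 3 k).selmerGroup = 3 ^ (k + 1) * 3 ^ n₀ →
        ∃ e ∈ (propagatedSelmerStructure W 3 k).selmerGroup,
          ∃ m ∈ (W.kummerSelmerStructure (((3 : ℕ) : ℤ) ^ k * ((3 : ℕ) : ℤ))).selmerGroup,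
            g ∅ = 3 ^ n₀ • e + m) :
    ∃ dd : ℕ, kuriharaPartialDeepInfty W 3 D.f = dd ∧
      ((padicValNat 3 (Nat.card (AddCommGroup.primaryComponent W.sha 3)) + dd : ℕ) : ℕ∞) ≤
        kuriharaPartial W 3 D.f 0 := by
  haveI : Fact (Nat.Prime 3) := ⟨Nat.prime_three⟩
  obtain ⟨inv, hperf, hsum, -, hcompl⟩ := hPT 3
  obtain ⟨inv', hperf', hsum', hcompl', hinj'⟩ := exists_localInvariants_three_pow_of_poitouTate hPT
  exact deepUpper_optimal_of_ports_of_towerSurj hS24 hS24₂ hGZK W hadd hc3 htower ht0 D hopt hcD hint hord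
    inv hperf hsum hcompl inv' hperf' hsum' hcompl' hinj' v₃ hv₃ η hη hPort hStub

/-- **Crux 19076 (`DeepUpperAtThree`) on the Kato stratum, CLASS-WIDE.**  Let `W₀` be a globally minimal
elliptic curve carrying an OPTIMAL parametrisation datum `D₀` with `3 ∤ c_{D₀}` and `3 ∤ c₃(W₀)`, the
repaired dictionary port PORT″ at `(v₃, η, D₀)` and the STUB port at `W₀`; let `W` be ANY globally minimal
curve `ℚ`-isogenous to `W₀` with the `3`-adic tower onto, additive at `3`, `E(ℚ₃)[3] = 0`, `3`-integral
plus symbols and `ord(δ̃) = 0` for `D₀.f` (the newform of the class).  Then, GRANTED [S24] (1)(2), GZK and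
Poitou–Tate: `∂^{(∞)}_deep = d ∈ ℕ` and `ord₃ #Ш(W)(3) + d ≤ ∂⁽⁰⁾` AT `W`.
[cite: Kim2025RefinedTNC, Thm 1.1] [cite: Sakamoto2024, Thm. 4.4 (p. 926)] [cite: MilneADT2006, Ch. I, Thm. 4.10]
[cite: SilvermanAEC2009, Cor. III.4.11] [cite: MazurRubin2004, Thm. 4.4.1] -/
theorem deepUpper_conclusion_classwide_of_ports_of_poitouTate
    (hS24 : Sakamoto2024.kolyvaginSystems_freeRankOne_zmod_three_pow)
    (hS24₂ : Sakamoto2024.kolyvaginSystems_idealOfBasis_eq_fittingIdeal_zmod_three_pow)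
    (hGZK : rank_eq_analyticRank_of_analyticRank_le_one)
    (hPT : poitouTate_selmerStructure_duality ℚ)
    (W W₀ : WeierstrassCurve ℚ) [W.IsElliptic] [W.IsGloballyMinimal] [W₀.IsElliptic]
    [W₀.IsGloballyMinimal] (hiso : IsIsogenous W W₀)
    -- the row, read at `W`
    (hadd : haveI : Fact (Nat.Prime 3) := ⟨Nat.prime_three⟩; Addv W 3)
    (htower : ∀ m : ℕ, W.HasSurjectiveModNGaloisRep (3 ^ m : ℕ))
    (ht0 : Nat.card {Q : (W.baseChange ℚ_[3]).toAffine.Point // (3 : ℕ) • Q = 0} = 1)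
    -- the optimal datum of the class, at `W₀`
    (hc3 : ¬ 3 ∣ (W₀.baseChange ℚ_[3]).localTamagawaNumber ℤ_[3])
    {N : ℕ} [NeZero N] (D₀ : ModularParametrizationData W₀ N)
    (hopt : ∀ z ∈ D₀.L.lattice, ∃ w ∈ periodLattice D₀.f, z = D₀.c * w)
    (hcD : ¬ (3 : ℤ) ∣ D₀.maninConstant)
    (hint : ∀ r : ℚ, ratPlusSymbol D₀.f r ≠ 0 → 0 ≤ padicValRat 3 (ratPlusSymbol D₀.f r))
    (v₃ : HeightOneSpectrum (𝓞 ℚ)) (hv₃ : ((3 : ℕ) : 𝓞 ℚ) ∈ v₃.asIdeal)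
    (η : (q : HeightOneSpectrum (𝓞 ℚ)) → (ZMod (Ideal.absNorm q.asIdeal))ˣ)
    (hη : ∀ q : HeightOneSpectrum (𝓞 ℚ), Subgroup.zpowers (η q) = ⊤)
    (hPort : KatoKuriharaPortThreeAtWith₂ W₀ 0 v₃ η D₀)
    (hStub : ∀ (k : ℕ)
      (Dk : KolyvaginDatum (W₀.torsionGaloisModule (((3 : ℕ) : ℤ) ^ k * ((3 : ℕ) : ℤ))))
      (g : Finset (HeightOneSpectrum (𝓞 ℚ)) →
        galoisCohomology (W₀.torsionGaloisModule (((3 : ℕ) : ℤ) ^ k * ((3 : ℕ) : ℤ))) 1)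
      (n₀ : ℕ), Dk.IsCanonicalTauDatumThreeAtWith W₀ k k η →
        g ∈ Dk.kolyvaginSystems (propagatedSelmerStructure W₀ 3 k) →
        (∀ κ ∈ Dk.kolyvaginSystems (propagatedSelmerStructure W₀ 3 k), ∃ a : ℕ, κ = a • g) →
        Nat.card (propagatedSelmerStructure W₀ 3 k).selmerGroup = 3 ^ (k + 1) * 3 ^ n₀ →
        ∃ e ∈ (propagatedSelmerStructure W₀ 3 k).selmerGroup,
          ∃ m ∈ (W₀.kummerSelmerStructure (((3 : ℕ) : ℤ) ^ k * ((3 : ℕ) : ℤ))).selmerGroup,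
            g ∅ = 3 ^ n₀ • e + m)
    (hord : kuriharaVanishingOrder W 3 D₀.f = 0) :
    ∃ dd : ℕ, kuriharaPartialDeepInfty W 3 D₀.f = dd ∧
      ((padicValNat 3 (Nat.card (AddCommGroup.primaryComponent W.sha 3)) + dd : ℕ) : ℕ∞) ≤
        kuriharaPartial W 3 D₀.f 0 := by
  haveI : Fact (Nat.Prime 3) := ⟨Nat.prime_three⟩
  have hirr : W.HasIrreducibleModPGaloisRep 3 := hasIrreducibleModPGaloisRep_of_tower htower
  have h₀ := deepUpper_optimal_of_ports_of_poitouTate hS24 hS24₂ hGZK hPT W₀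
    ((addv_iff_of_isIsogenous hiso).mp hadd) hc3 (towerSurjective_of_isIsogenous hiso htower)
    (by rw [← natCard_torsion_padic_eq_of_isIsogenous hiso hirr]; exact ht0) D₀ hopt hcD hint
    (by rw [← kuriharaVanishingOrder_eq_of_isIsogenous D₀.f hiso hirr]; exact hord) v₃ hv₃ η hη hPort hStub
  exact (deepUpper_conclusion_iff_of_isIsogenous D₀.f hiso hirr).mpr h₀

/-- **Crux 19077 (`ShallowEqDeepAtTorsionFree`) on the Kato stratum, CLASS-WIDE, from the SAME inputs.**
kim3's `shallowEqDeep_conclusion_classwide_of_ports_of_deepUpper` with its hypothesis `hU` (crux 19076's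
conclusion at `W`) PRODUCED by `deepUpper_conclusion_classwide_of_ports_of_poitouTate`: for `W ~ W₀` as
there (datum at the conductor, `hN`), `∂^{(∞)}_deep(δ̃) ≤ ∂^{(∞)}(δ̃)` at `W`, GRANTED [S24] (1)(2), GZK,
Poitou–Tate, PORT″ and the STUB. [cite: Kim2025RefinedTNC, Thm 1.1] [cite: Sakamoto2024, Thm. 4.4 (p. 926)]
[cite: MazurRubin2004, Thm. 4.4.1] [cite: MilneADT2006, Ch. I, Thm. 4.10] -/
theorem shallowEqDeep_conclusion_classwide_of_ports_of_stub
    (hS24 : Sakamoto2024.kolyvaginSystems_freeRankOne_zmod_three_pow)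
    (hS24₂ : Sakamoto2024.kolyvaginSystems_idealOfBasis_eq_fittingIdeal_zmod_three_pow)
    (hGZK : rank_eq_analyticRank_of_analyticRank_le_one)
    (hPT : poitouTate_selmerStructure_duality ℚ)
    (W W₀ : WeierstrassCurve ℚ) [W.IsElliptic] [W.IsGloballyMinimal] [W₀.IsElliptic]
    [W₀.IsGloballyMinimal] (hiso : IsIsogenous W W₀)
    (hadd : haveI : Fact (Nat.Prime 3) := ⟨Nat.prime_three⟩; Addv W 3)
    (htower : ∀ m : ℕ, W.HasSurjectiveModNGaloisRep (3 ^ m : ℕ))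
    (ht0 : Nat.card {Q : (W.baseChange ℚ_[3]).toAffine.Point // (3 : ℕ) • Q = 0} = 1)
    (hc3 : ¬ 3 ∣ (W₀.baseChange ℚ_[3]).localTamagawaNumber ℤ_[3])
    {N : ℕ} [NeZero N] (hN : N = W₀.conductorNorm ℤ) (D₀ : ModularParametrizationData W₀ N)
    (hopt : ∀ z ∈ D₀.L.lattice, ∃ w ∈ periodLattice D₀.f, z = D₀.c * w)
    (hcD : ¬ (3 : ℤ) ∣ D₀.maninConstant)
    (hint : ∀ r : ℚ, ratPlusSymbol D₀.f r ≠ 0 → 0 ≤ padicValRat 3 (ratPlusSymbol D₀.f r))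
    (v₃ : HeightOneSpectrum (𝓞 ℚ)) (hv₃ : ((3 : ℕ) : 𝓞 ℚ) ∈ v₃.asIdeal)
    (η : (q : HeightOneSpectrum (𝓞 ℚ)) → (ZMod (Ideal.absNorm q.asIdeal))ˣ)
    (hη : ∀ q : HeightOneSpectrum (𝓞 ℚ), Subgroup.zpowers (η q) = ⊤)
    (hPort : KatoKuriharaPortThreeAtWith₂ W₀ 0 v₃ η D₀)
    (hStub : ∀ (k : ℕ)
      (Dk : KolyvaginDatum (W₀.torsionGaloisModule (((3 : ℕ) : ℤ) ^ k * ((3 : ℕ) : ℤ))))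
      (g : Finset (HeightOneSpectrum (𝓞 ℚ)) →
        galoisCohomology (W₀.torsionGaloisModule (((3 : ℕ) : ℤ) ^ k * ((3 : ℕ) : ℤ))) 1)
      (n₀ : ℕ), Dk.IsCanonicalTauDatumThreeAtWith W₀ k k η →
        g ∈ Dk.kolyvaginSystems (propagatedSelmerStructure W₀ 3 k) →
        (∀ κ ∈ Dk.kolyvaginSystems (propagatedSelmerStructure W₀ 3 k), ∃ a : ℕ, κ = a • g) →
        Nat.card (propagatedSelmerStructure W₀ 3 k).selmerGroup = 3 ^ (k + 1) * 3 ^ n₀ →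
        ∃ e ∈ (propagatedSelmerStructure W₀ 3 k).selmerGroup,
          ∃ m ∈ (W₀.kummerSelmerStructure (((3 : ℕ) : ℤ) ^ k * ((3 : ℕ) : ℤ))).selmerGroup,
            g ∅ = 3 ^ n₀ • e + m)
    (hord : kuriharaVanishingOrder W 3 D₀.f = 0) :
    kuriharaPartialDeepInfty W 3 D₀.f ≤ kuriharaPartialInfty W 3 D₀.f :=
  shallowEqDeep_conclusion_classwide_of_ports_of_deepUpper hS24 hS24₂ hGZK hPT W W₀ hiso hadd htower ht0 hc3
    hN D₀ hopt hcD v₃ hv₃ η hη hPort hord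
    (deepUpper_conclusion_classwide_of_ports_of_poitouTate hS24 hS24₂ hGZK hPT W W₀ hiso hadd htower ht0 hc3
      D₀ hopt hcD hint v₃ hv₃ η hη hPort hStub hord)

end Summit.BirchSwinnertonDyer.BirchSwinnertonDyer.Theorems.KimAtThreeDeepUpperOfPortsClasswide

end
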